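import Mathlib
import Summits.NavierStokesRegularity.NavierStokesRegularity.Theorems.EulerZoomLiouvillePowerGaugeEulerLiouvilleDSSSelfSimilarPath
import HarnessLib.Audit

/-!
# Crux E `PowerGaugeEulerLiouville` (stmt-NavierStokesRegularity-19832): GEOMETRIC DEPLETION AT THE PERMANENT NODES — the node clause of the K-A″ DSS stratum
# only needs the STRETCHING RATE ALONG THE VORTICITY DIRECTION at vortical self-similar particle paths (width seat ns-cas-k2 g2)

Route `EulerZoomLiouville` (NavierStokesRegularity), crux E.  Sharpening of `…DSSSimilarityNodes` / `…DSSSimilarityBernoulliMember`: the kill of a confined resting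
trajectory uses the stretching form only on its OWN vorticity (Chae's `α = ⟪∇u ξ, ξ⟫`, `ξ = ω/|ω|`), and vorticity DIRECTIONS pass to the limit at points where the
vorticity does not vanish.  Hence at a VORTICAL permanent node (`ω(t,(−t)ⁿy*) ≠ 0`; then `≠ 0` at every phase) only `(−t) α(t,(−t)ⁿy*) ≤ κ` is needed, the full form
`(−t)⟪∇u v,v⟫ ≤ κ‖v‖²` being kept at NON-VORTICAL permanent nodes:
* `curl_eq_zero_of_eventually_subcritical_along` — KILL along the vorticity: `⟪∇u(s,X)ω, ω⟫ ≤ κ‖ω‖²/(−s)` for `s ≤ σ₁` (`ω = ω(s,X(s))`, `κ < 1`) + Type-I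
  vorticity along the trajectory ⇒ `ω(τ₀,x₀) = 0`;
* `curl_dss_iterate` — `ω(τ,y) = Tᵐ ω(Tᵐτ, lᵐy)` (directions are DSS-invariant);
* `eventually_subcriticalAlong_of_permanentNodes` — DSS member, resting confined trajectory, DEPLETED permanent nodes in the ball ⇒ eventually
  `⟪∇u(s,X)ω, ω⟫ ≤ κ'‖ω‖²/(−s)`.

WHAT THIS IS NOT: not NS regularity, not the crux E — Lagrangian bookkeeping for hypothetical DSS blow-up members. [folklore; Chae2010 Thm 1.1 (the rate `α`)]
-/

noncomputable section

set_option linter.dupNamespace false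

open MeasureTheory Set Filter Topology Metric Function
open scoped NNReal ENNReal ContDiff InnerProductSpace RealInnerProductSpace

namespace Summit.NavierStokesRegularity.NavierStokesRegularity.Theorems.PowerGaugeEulerLiouville.SimilarityBernoulli

open Literature.Analysis Literature.Analysis.FluidPDE Literature.Analysis.FunctionSpaces
open Summit.NavierStokesRegularity.NavierStokesRegularity.Theorems.PowerGaugeEulerLiouville.VorticityBirth

variable {u : ℝ → EuclideanSpace ℝ (Fin 3) → EuclideanSpace ℝ (Fin 3)} {p : ℝ → EuclideanSpace ℝ (Fin 3) → ℝ} {Λ : ℝ → ℝ} {ρ l : ℝ}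

/-! ### Kill along the vorticity direction -/

/-- **KILL ALONG THE VORTICITY.**  Classical Euler on `(−∞,0)` with a continuous gradient majorant; along the backward trajectory `φ` of `(τ₀,x₀)`, for `s ≤ σ₁`,
the stretching rate on the vorticity itself is subcritical, `⟪∇u(s,φ)ω, ω⟫ ≤ κ‖ω‖²/(−s)` (`ω = ω(s,φ(s))`, `κ < 1`), and `(−s)‖ω(s,φ(s))‖ ≤ C`.  Then `ω(τ₀,x₀) = 0`.
[cite: Chae2010, Thm 1.1 (stretching rate `α` along the vorticity, one trajectory)] -/
theorem curl_eq_zero_of_eventually_subcritical_along (hcl : IsClassicalEulerSolutionOn (Iio 0) 0 u p)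
    (hΛc : ContinuousOn Λ (Iio 0)) (hΛ : ∀ s : ℝ, s < 0 → ∀ y, ‖fderiv ℝ (u s) y‖ ≤ Λ s)
    {τ₀ σ₁ κ C : ℝ} (hτ₀ : τ₀ < 0) (hσ₁ : σ₁ ≤ τ₀) (hκ : κ < 1) {x₀ : EuclideanSpace ℝ (Fin 3)}
    (hsub : ∀ s : ℝ, s ≤ σ₁ →
      ⟪fderiv ℝ (u s) (ODE.evolutionMap u τ₀ s x₀) (curl (u s) (ODE.evolutionMap u τ₀ s x₀)),
          curl (u s) (ODE.evolutionMap u τ₀ s x₀)⟫ ≤ κ / (-s) * ‖curl (u s) (ODE.evolutionMap u τ₀ s x₀)‖ ^ 2)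
    (hC : ∀ s : ℝ, s ≤ σ₁ → (-s) * ‖curl (u s) (ODE.evolutionMap u τ₀ s x₀)‖ ≤ C) :
    curl (u τ₀) x₀ = 0 := by
  -- adapted from …SimilarityBernoulliRest (`curl_eq_zero_of_eventually_subcritical`): the quadratic form is only evaluated on the vorticity
  have hσ₁0 : σ₁ < 0 := lt_of_le_of_lt hσ₁ hτ₀
  have hlip : ODE.IsUniformlyLipschitzOn u (Iio 0) := isUniformlyLipschitzOn hcl hΛc hΛ
  set X : ℝ → EuclideanSpace ℝ (Fin 3) → EuclideanSpace ℝ (Fin 3) := fun s y => ODE.evolutionMap u τ₀ s y with hX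
  have hXu : ∀ t ∈ Iio (0 : ℝ), ∀ y, HasDerivWithinAt (fun s => X s y) (u t (X t y)) (Iio 0) t :=
    fun t ht y => hlip.hasDerivWithinAt_evolutionMap (convex_Iio 0) hτ₀ ht y
  set G : ℝ → ℝ := fun s => ‖curl (u s) (X s x₀)‖ ^ 2 with hG
  have hG' : ∀ s : ℝ, s < 0 →
      HasDerivAt G (2 * ⟪curl (u s) (X s x₀), fderiv ℝ (u s) (X s x₀) (curl (u s) (X s x₀))⟫) s := by
    intro s hs
    exact ((hcl.hasDerivWithinAt_curl_flow (uniqueDiffOn_Iio 0) hXu (mem_Iio.2 hs) x₀).hasDerivAt (Iio_mem_nhds hs)).norm_sq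
  set P : ℝ → ℝ := fun s => (-s) ^ (2 * κ) with hP
  have hP' : ∀ s : ℝ, s < 0 → HasDerivAt P ((-1) * (2 * κ) * (-s) ^ (2 * κ - 1)) s := fun s hs =>
    (hasDerivAt_neg s).rpow_const (Or.inl (by linarith))
  set F : ℝ → ℝ := fun s => P s * G s with hF
  have hF' : ∀ s : ℝ, s < 0 → HasDerivAt F ((-1) * (2 * κ) * (-s) ^ (2 * κ - 1) * G s +
      P s * (2 * ⟪curl (u s) (X s x₀), fderiv ℝ (u s) (X s x₀) (curl (u s) (X s x₀))⟫)) s :=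
    fun s hs => (hP' s hs).mul (hG' s hs)
  have hF'le : ∀ s : ℝ, s ≤ σ₁ → (-1) * (2 * κ) * (-s) ^ (2 * κ - 1) * G s +
      P s * (2 * ⟪curl (u s) (X s x₀), fderiv ℝ (u s) (X s x₀) (curl (u s) (X s x₀))⟫) ≤ 0 := by
    intro s hs
    have hs0 : 0 < -s := by linarith
    set w := curl (u s) (X s x₀) with hw
    have hq : ⟪w, fderiv ℝ (u s) (X s x₀) w⟫ ≤ κ / (-s) * ‖w‖ ^ 2 := by
      rw [real_inner_comm]; exact hsub s hs
    have hPw : P s * (2 * ⟪w, fderiv ℝ (u s) (X s x₀) w⟫) ≤ P s * (2 * (κ / (-s) * ‖w‖ ^ 2)) :=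
      mul_le_mul_of_nonneg_left (by linarith) (Real.rpow_nonneg hs0.le _)
    have hid : P s * (2 * (κ / (-s) * ‖w‖ ^ 2)) = (2 * κ) * (-s) ^ (2 * κ - 1) * G s := by
      simp only [hP, hG, ← hw]
      rw [Real.rpow_sub_one hs0.ne']
      field_simp
    have hG0 : G s = ‖w‖ ^ 2 := by simp only [hG, hw]
    nlinarith [hPw, hid]
  have hanti : AntitoneOn F (Iic σ₁) := by
    refine antitoneOn_of_hasDerivWithinAt_nonpos (convex_Iic σ₁)
      (fun s hs => (hF' s (lt_of_le_of_lt hs hσ₁0)).continuousAt.continuousWithinAt)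
      (fun s hs => by
        rw [interior_Iic] at hs
        exact (hF' s (lt_of_lt_of_le hs hσ₁0.le)).hasDerivWithinAt) fun s hs => ?_
    rw [interior_Iic] at hs
    exact hF'le s (le_of_lt hs)
  have hbound : ∀ s : ℝ, s ≤ σ₁ → F σ₁ ≤ C ^ 2 * (-s) ^ (2 * κ - 2) := by
    intro s hs
    have hs0 : 0 < -s := by linarith
    have h1 : F σ₁ ≤ F s := hanti (mem_Iic.2 hs) (mem_Iic.2 le_rfl) hs
    have hωs : ‖curl (u s) (X s x₀)‖ ≤ C / (-s) := by
      rw [le_div_iff₀ hs0, mul_comm]; exact hC s hs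
    have h2 : G s ≤ (C / (-s)) ^ 2 := by
      simp only [hG]; exact pow_le_pow_left₀ (norm_nonneg _) hωs 2
    have h3 : F s ≤ (-s) ^ (2 * κ) * (C / (-s)) ^ 2 := mul_le_mul_of_nonneg_left h2 (Real.rpow_nonneg hs0.le _)
    have h4 : (-s) ^ (2 * κ) * (C / (-s)) ^ 2 = C ^ 2 * (-s) ^ (2 * κ - 2) := by
      rw [Real.rpow_sub hs0, show (2 : ℝ) = ((2 : ℕ) : ℝ) by norm_num, Real.rpow_natCast]
      field_simp
    linarith
  have hlim : Tendsto (fun r : ℝ => C ^ 2 * r ^ (2 * κ - 2)) atTop (𝓝 0) := by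
    have h1 : Tendsto (fun r : ℝ => r ^ (-(2 - 2 * κ))) atTop (𝓝 0) := tendsto_rpow_neg_atTop (by linarith)
    have h2 := h1.const_mul (C ^ 2)
    simp only [mul_zero] at h2
    refine h2.congr fun r => ?_
    rw [show -(2 - 2 * κ) = 2 * κ - 2 by ring]
  have hFσ₁ : F σ₁ ≤ 0 := by
    refine ge_of_tendsto hlim ?_
    filter_upwards [eventually_ge_atTop (-σ₁)] with r hr
    have h := hbound (-r) (by linarith)
    rwa [neg_neg] at h
  have hGσ₁ : G σ₁ = 0 := by
    have hPpos : 0 < P σ₁ := Real.rpow_pos_of_pos (by linarith) _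
    have hG0 : 0 ≤ G σ₁ := sq_nonneg _
    have : F σ₁ = P σ₁ * G σ₁ := rfl
    nlinarith
  have hω : curl (u σ₁) (X σ₁ x₀) = 0 := by
    have : ‖curl (u σ₁) (X σ₁ x₀)‖ ^ 2 = 0 := hGσ₁
    exact norm_eq_zero.1 (pow_eq_zero_iff two_ne_zero |>.1 this)
  rw [curl_eq_fderiv_evolutionMap_apply_two_time_local hcl hΛc hΛ hσ₁0 hτ₀ x₀]
  simp only [hX] at hω
  rw [hω, map_zero]

/-! ### Vorticity directions are DSS-invariant -/

/-- **The `m`-fold DSS law for the vorticity**: `ω(τ, y) = Tᵐ ω(Tᵐτ, lᵐy)`, `T = l^{2+ρ}`. [folklore] -/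
theorem curl_dss_iterate (hl : 1 < l) (hρ : 0 < 2 + ρ)
    (hdss : ∀ τ : ℝ, τ < 0 → ∀ y, u τ y = (l ^ (1 + ρ)) • u ((l ^ (2 + ρ)) * τ) (l • y))
    (m : ℕ) {τ : ℝ} (hτ : τ < 0) (y : EuclideanSpace ℝ (Fin 3)) :
    curl (u τ) y = ((l ^ (2 + ρ)) ^ m) • curl (u ((l ^ (2 + ρ)) ^ m * τ)) (l ^ m • y) := by
  have hl0 : 0 < l := zero_lt_one.trans hl
  have hfun : u τ = fun y => ((l ^ (1 + ρ)) ^ m) • u ((l ^ (2 + ρ)) ^ m * τ) (l ^ m • y) :=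
    funext fun y => dss_iterate hl hρ hdss m hτ y
  rw [hfun, curl_smul_comp_smul, ← period_pow_eq hl0 m]

/-! ### Depleted permanent nodes make a resting trajectory eventually subcritical along its vorticity -/

/-- **DEPLETED PERMANENT NODES ⇒ EVENTUALLY SUBCRITICAL ALONG THE VORTICITY.**  `(u,p)` classical on `(−∞,0)`, `l`-DSS for the class scaling; `X` a particle
path confined to `‖X(s)‖ ≤ R(−s)ⁿ` for `s ≤ τ₀` (`n = 1/(2+ρ)`) whose similarity speed tends to `0`; every permanent node `y*` of the ball is DEPLETED with
constant `κ`: at phases where the node is VORTICAL only Chae's rate is bounded, `(−t)⟪∇u ω, ω⟫ ≤ κ‖ω‖²` (`ω = ω(t,(−t)ⁿy*) ≠ 0`), and where it is non-vortical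
the full form is, `(−t)⟪∇u v, v⟫ ≤ κ‖v‖²`.  Then for every `κ' > κ` there is `σ₁ ≤ τ₀` with `⟪∇u(s,X(s))ω, ω⟫ ≤ κ'‖ω‖²/(−s)` for `s ≤ σ₁`, `ω = ω(s, X(s))`.
[folklore] -/
theorem eventually_subcriticalAlong_of_permanentNodes (hcl : IsClassicalEulerSolutionOn (Iio 0) 0 u p) (hl : 1 < l)
    (hρ : 0 < 2 + ρ) (hdss : ∀ τ : ℝ, τ < 0 → ∀ y, u τ y = (l ^ (1 + ρ)) • u ((l ^ (2 + ρ)) * τ) (l • y))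
    {X : ℝ → EuclideanSpace ℝ (Fin 3)} {τ₀ R κ κ' : ℝ} (hκ : κ < κ')
    (hX : ∀ s : ℝ, s < 0 → HasDerivAt X (u s (X s)) s)
    (hconf : ∀ s : ℝ, s ≤ τ₀ → ‖X s‖ ≤ R * (-s) ^ (2 + ρ)⁻¹)
    (hrest : Tendsto (fun s => (-s) ^ (1 - (2 + ρ)⁻¹) * ‖u s (X s) + ((2 + ρ)⁻¹ / (-s)) • X s‖) atBot (𝓝 0))
    (hnodeV : ∀ y : EuclideanSpace ℝ (Fin 3), ‖y‖ ≤ R →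
      (∀ t : ℝ, t < 0 → u t ((-t) ^ (2 + ρ)⁻¹ • y) = (-((2 + ρ)⁻¹ * (-t) ^ ((2 + ρ)⁻¹ - 1))) • y) →
      ∀ t : ℝ, t < 0 → curl (u t) ((-t) ^ (2 + ρ)⁻¹ • y) ≠ 0 →
        (-t) * ⟪fderiv ℝ (u t) ((-t) ^ (2 + ρ)⁻¹ • y) (curl (u t) ((-t) ^ (2 + ρ)⁻¹ • y)), curl (u t) ((-t) ^ (2 + ρ)⁻¹ • y)⟫ ≤
          κ * ‖curl (u t) ((-t) ^ (2 + ρ)⁻¹ • y)‖ ^ 2)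
    (hnode0 : ∀ y : EuclideanSpace ℝ (Fin 3), ‖y‖ ≤ R →
      (∀ t : ℝ, t < 0 → u t ((-t) ^ (2 + ρ)⁻¹ • y) = (-((2 + ρ)⁻¹ * (-t) ^ ((2 + ρ)⁻¹ - 1))) • y) →
      ∀ t : ℝ, t < 0 → curl (u t) ((-t) ^ (2 + ρ)⁻¹ • y) = 0 → ∀ v : EuclideanSpace ℝ (Fin 3),
        (-t) * ⟪fderiv ℝ (u t) ((-t) ^ (2 + ρ)⁻¹ • y) v, v⟫ ≤ κ * ‖v‖ ^ 2) :
    ∃ σ₁ : ℝ, σ₁ ≤ τ₀ ∧ ∀ s : ℝ, s ≤ σ₁ →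
      ⟪fderiv ℝ (u s) (X s) (curl (u s) (X s)), curl (u s) (X s)⟫ ≤ κ' / (-s) * ‖curl (u s) (X s)‖ ^ 2 := by
  have hl0 : 0 < l := zero_lt_one.trans hl
  set n : ℝ := (2 + ρ)⁻¹ with hn
  set T : ℝ := l ^ (2 + ρ) with hT
  have hT1 : 1 < T := Real.one_lt_rpow hl hρ
  have hT0 : 0 < T := zero_lt_one.trans hT1
  by_contra H
  push Not at H
  choose sq hsq hbq using fun j : ℕ => H (min τ₀ (-(j : ℝ) - 1)) (min_le_left _ _)
  have hsqτ : ∀ j, sq j ≤ τ₀ := fun j => (hsq j).trans (min_le_left _ _)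
  have hsqj : ∀ j, sq j ≤ -(j : ℝ) - 1 := fun j => (hsq j).trans (min_le_right _ _)
  have hsq1 : ∀ j, sq j ≤ -1 := fun j => (hsqj j).trans (by have := (Nat.cast_nonneg j : (0:ℝ) ≤ j); linarith)
  have hsq0 : ∀ j, sq j < 0 := fun j => by linarith [hsq1 j]
  -- the vorticity along the trajectory at the bad times is non-zero; its direction
  have hcwne : ∀ j, curl (u (sq j)) (X (sq j)) ≠ 0 := by
    intro j h
    have := hbq j
    rw [h] at this
    simp at this
  set wq : ℕ → EuclideanSpace ℝ (Fin 3) := fun j => (‖curl (u (sq j)) (X (sq j))‖⁻¹) • curl (u (sq j)) (X (sq j)) with hwq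
  have hwq1 : ∀ j, ‖wq j‖ = 1 := fun j => by
    simp only [hwq]; rw [norm_smul, Real.norm_eq_abs, abs_of_pos (inv_pos.2 (norm_pos_iff.2 (hcwne j))),
      inv_mul_cancel₀ (norm_ne_zero_iff.2 (hcwne j))]
  have hbad : ∀ j, κ' < (-sq j) * ⟪fderiv ℝ (u (sq j)) (X (sq j)) (wq j), wq j⟫ := by
    intro j
    have hs0 : 0 < -sq j := by linarith [hsq0 j]
    have hvpos : 0 < ‖curl (u (sq j)) (X (sq j))‖ := norm_pos_iff.2 (hcwne j)
    have h1 := hbq j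
    have e : ⟪fderiv ℝ (u (sq j)) (X (sq j)) (wq j), wq j⟫ =
        ‖curl (u (sq j)) (X (sq j))‖⁻¹ ^ 2 *
          ⟪fderiv ℝ (u (sq j)) (X (sq j)) (curl (u (sq j)) (X (sq j))), curl (u (sq j)) (X (sq j))⟫ := by
      simp only [hwq, map_smul, real_inner_smul_left, real_inner_smul_right]; ring
    rw [e]
    have hsne : sq j ≠ 0 := (hsq0 j).ne
    have hvne' : ‖curl (u (sq j)) (X (sq j))‖ ≠ 0 := hvpos.ne'
    have h2 : κ' = (-sq j) * (‖curl (u (sq j)) (X (sq j))‖⁻¹ ^ 2 *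
        (κ' / (-sq j) * ‖curl (u (sq j)) (X (sq j))‖ ^ 2)) := by field_simp
    rw [h2]
    exact mul_lt_mul_of_pos_left (mul_lt_mul_of_pos_left h1 (by positivity)) hs0
  choose mq tq htq hst using fun j => exists_fundamental_period_of_le hT1 (hsq1 j)
  have htq0 : ∀ j, tq j < 0 := fun j => by linarith [(htq j).2]
  have hneg_inv : ∀ s : ℝ, s < 0 → (-s) ^ (-n) = ((-s) ^ n)⁻¹ := fun s hs => Real.rpow_neg (by linarith) n
  set yq : ℕ → EuclideanSpace ℝ (Fin 3) := fun j => ((-sq j) ^ (-n)) • X (sq j) with hyq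
  have hyqR : ∀ j, ‖yq j‖ ≤ R := by
    intro j
    have hs0 : 0 < -sq j := by linarith [hsq0 j]
    have hp : 0 < (-sq j) ^ n := Real.rpow_pos_of_pos hs0 _
    simp only [hyq]
    rw [norm_smul, Real.norm_eq_abs, hneg_inv _ (hsq0 j), abs_of_pos (inv_pos.2 hp), inv_mul_le_iff₀ hp, mul_comm]
    exact hconf (sq j) (hsqτ j)
  have hXy : ∀ j, l ^ (mq j) • ((-tq j) ^ n • yq j) = X (sq j) := by
    intro j
    have hs0 : 0 < -sq j := by linarith [hsq0 j]
    have hp : 0 < (-sq j) ^ n := Real.rpow_pos_of_pos hs0 _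
    simp only [hyq]
    rw [smul_smul, smul_smul, pow_mul_rpow_eq hl hρ (mq j) (htq0 j), ← hT, ← hst j, hneg_inv _ (hsq0 j),
      mul_inv_cancel₀ hp.ne', one_smul]
  -- the vorticity at the transferred point has the same direction
  set cq : ℕ → EuclideanSpace ℝ (Fin 3) := fun j => curl (u (tq j)) ((-tq j) ^ n • yq j) with hcq
  have hccw : ∀ j, cq j = (T ^ (mq j)) • curl (u (sq j)) (X (sq j)) := by
    intro j
    simp only [hcq]
    rw [curl_dss_iterate hl hρ hdss (mq j) (htq0 j), ← hT, ← hst j, hXy j]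
  have hwc : ∀ j, wq j = (‖cq j‖⁻¹) • cq j := by
    intro j
    have hTm : 0 < T ^ (mq j) := pow_pos hT0 _
    simp only [hwq]
    rw [hccw j, norm_smul, Real.norm_eq_abs, abs_of_pos hTm, smul_smul]
    congr 1
    field_simp
  have hbad' : ∀ j, κ' < (-tq j) * ⟪fderiv ℝ (u (tq j)) ((-tq j) ^ n • yq j) (wq j), wq j⟫ := by
    intro j
    have h := stretching_transfer hl hρ hdss (mq j) (htq0 j) (yq j) (wq j)
    rw [hXy j, ← hT, ← hst j] at h
    rw [← h]
    exact hbad j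
  set Kc : Set (EuclideanSpace ℝ (Fin 3) × ℝ × EuclideanSpace ℝ (Fin 3)) :=
    closedBall 0 R ×ˢ (Icc (-T) (-1) ×ˢ sphere 0 1) with hKc
  have hKcpt : IsCompact Kc := (isCompact_closedBall _ _).prod (isCompact_Icc.prod (isCompact_sphere _ _))
  set z : ℕ → EuclideanSpace ℝ (Fin 3) × ℝ × EuclideanSpace ℝ (Fin 3) := fun j => (yq j, tq j, wq j) with hz
  have hzK : ∀ j, z j ∈ Kc := fun j =>
    ⟨mem_closedBall_zero_iff.2 (hyqR j), htq j, mem_sphere_zero_iff_norm.2 (hwq1 j)⟩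
  obtain ⟨zs, hzs, φ, hφ, hlim⟩ := hKcpt.tendsto_subseq hzK
  obtain ⟨ys, ts, ws⟩ := zs
  obtain ⟨hys, hts, hws⟩ := hzs
  rw [mem_closedBall_zero_iff] at hys
  rw [mem_sphere_zero_iff_norm] at hws
  have hts0 : ts < 0 := by linarith [hts.2]
  have hy_lim : Tendsto (fun j => yq (φ j)) atTop (𝓝 ys) := (continuous_fst.tendsto _).comp hlim
  have ht_lim : Tendsto (fun j => tq (φ j)) atTop (𝓝 ts) :=
    (continuous_fst.tendsto _).comp ((continuous_snd.tendsto _).comp hlim)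
  have hw_lim : Tendsto (fun j => wq (φ j)) atTop (𝓝 ws) :=
    (continuous_snd.tendsto _).comp ((continuous_snd.tendsto _).comp hlim)
  -- the limit of the scaled stretching form
  have hDcont : ContinuousOn (uncurry fun t x => fderiv ℝ (u t) x) (Iio (0:ℝ) ×ˢ univ) :=
    (hcl.smooth_velocity.fderiv_slice isOpen_Iio.uniqueDiffOn).continuousOn
  have hpt_lim : Tendsto (fun j => ((tq (φ j), (-tq (φ j)) ^ n • yq (φ j)) : ℝ × EuclideanSpace ℝ (Fin 3))) atTop
      (𝓝 (ts, (-ts) ^ n • ys)) := by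
    refine ht_lim.prodMk_nhds ?_
    exact ((ht_lim.neg).rpow_const (Or.inl (by linarith))).smul hy_lim
  have hmem : (ts, (-ts) ^ n • ys) ∈ Iio (0:ℝ) ×ˢ (univ : Set (EuclideanSpace ℝ (Fin 3))) := ⟨hts0, mem_univ _⟩
  have hwithin := tendsto_nhdsWithin_iff.2 ⟨hpt_lim, Eventually.of_forall fun j =>
    Set.mk_mem_prod (mem_Iio.2 (htq0 (φ j))) (mem_univ ((-tq (φ j)) ^ n • yq (φ j)))⟩
  have hA_lim : Tendsto (fun j => fderiv ℝ (u (tq (φ j))) ((-tq (φ j)) ^ n • yq (φ j))) atTop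
      (𝓝 (fderiv ℝ (u ts) ((-ts) ^ n • ys))) := (hDcont _ hmem).tendsto.comp hwithin
  have hAw_lim : Tendsto (fun j => fderiv ℝ (u (tq (φ j))) ((-tq (φ j)) ^ n • yq (φ j)) (wq (φ j))) atTop
      (𝓝 (fderiv ℝ (u ts) ((-ts) ^ n • ys) ws)) :=
    (isBoundedBilinearMap_apply.continuous.tendsto _).comp (hA_lim.prodMk_nhds hw_lim)
  have hF_lim : Tendsto (fun j => (-tq (φ j)) * ⟪fderiv ℝ (u (tq (φ j))) ((-tq (φ j)) ^ n • yq (φ j)) (wq (φ j)), wq (φ j)⟫)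
      atTop (𝓝 ((-ts) * ⟪fderiv ℝ (u ts) ((-ts) ^ n • ys) ws, ws⟫)) :=
    ht_lim.neg.mul (hAw_lim.inner hw_lim)
  have hFge : κ' ≤ (-ts) * ⟪fderiv ℝ (u ts) ((-ts) ^ n • ys) ws, ws⟫ :=
    ge_of_tendsto hF_lim (Eventually.of_forall fun j => (hbad' (φ j)).le)
  -- `ys` is a permanent node
  have hφge : ∀ j : ℕ, (j : ℝ) ≤ (φ j : ℝ) := fun j => by exact_mod_cast hφ.id_le j
  have hperm : ∀ t : ℝ, t < 0 → u t ((-t) ^ n • ys) = (-(n * (-t) ^ (n - 1))) • ys := fun t ht =>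
    permanentNode_of_clusterPt hcl hl hρ hdss hX hrest (sq := sq ∘ φ)
      (fun j => (hsqj (φ j)).trans (by linarith [hφge j])) hy_lim ht
  -- the vorticity at the transferred points converges
  have hVcont : ContinuousOn (uncurry (vorticity u)) (Iio (0:ℝ) ×ˢ univ) :=
    (hcl.isSmoothSpaceTimeOn_vorticity_euler isOpen_Iio.uniqueDiffOn).continuousOn
  have hVfun : uncurry (vorticity u) = fun z : ℝ × EuclideanSpace ℝ (Fin 3) => curl (u z.1) z.2 := by
    funext z; rfl
  have hc_lim' : Tendsto ((fun z : ℝ × EuclideanSpace ℝ (Fin 3) => curl (u z.1) z.2) ∘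
      (fun j => ((tq (φ j), (-tq (φ j)) ^ n • yq (φ j)) : ℝ × EuclideanSpace ℝ (Fin 3)))) atTop
      (𝓝 (curl (u ts) ((-ts) ^ n • ys))) := by
    have h := (hVcont _ hmem).tendsto.comp hwithin
    rw [hVfun] at h
    exact h
  have hc_lim : Tendsto (fun j => cq (φ j)) atTop (𝓝 (curl (u ts) ((-ts) ^ n • ys))) :=
    hc_lim'.congr fun j => rfl
  by_cases hc0 : curl (u ts) ((-ts) ^ n • ys) = 0
  · -- non-vortical node: full form
    have hle := hnode0 ys hys hperm ts hts0 hc0 ws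
    rw [hws, one_pow, mul_one] at hle
    linarith
  · -- vortical node: the directions converge to the vorticity direction there
    set cs := curl (u ts) ((-ts) ^ n • ys) with hcs
    have hcspos : 0 < ‖cs‖ := norm_pos_iff.2 hc0
    have hdir : Tendsto (fun j => wq (φ j)) atTop (𝓝 ((‖cs‖⁻¹) • cs)) := by
      have h1 : Tendsto (fun j => ‖cq (φ j)‖⁻¹) atTop (𝓝 (‖cs‖⁻¹)) := (hc_lim.norm).inv₀ hcspos.ne'
      have h2 := h1.smul hc_lim
      exact h2.congr fun j => (hwc (φ j)).symm
    have hws_eq : ws = (‖cs‖⁻¹) • cs := tendsto_nhds_unique hw_lim hdir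
    have hle := hnodeV ys hys hperm ts hts0 hc0
    rw [← hcs] at hle
    have hform : (-ts) * ⟪fderiv ℝ (u ts) ((-ts) ^ n • ys) ws, ws⟫ = ‖cs‖⁻¹ ^ 2 * ((-ts) * ⟪fderiv ℝ (u ts) ((-ts) ^ n • ys) cs, cs⟫) := by
      rw [hws_eq, map_smul, real_inner_smul_left, real_inner_smul_right]; ring
    have h3 : ‖cs‖⁻¹ ^ 2 * ((-ts) * ⟪fderiv ℝ (u ts) ((-ts) ^ n • ys) cs, cs⟫) ≤ ‖cs‖⁻¹ ^ 2 * (κ * ‖cs‖ ^ 2) :=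
      mul_le_mul_of_nonneg_left hle (by positivity)
    have h4 : ‖cs‖⁻¹ ^ 2 * (κ * ‖cs‖ ^ 2) = κ := by field_simp
    linarith [hform, h3, h4]

end Summit.NavierStokesRegularity.NavierStokesRegularity.Theorems.PowerGaugeEulerLiouville.SimilarityBernoulli

end
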